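import Summits.QuantumFields.YangMills.Theorems.FluctuationComparisonRegPrIntLS2BetaChartReadDerivBkgLipschitz
import Summits.QuantumFields.YangMills.Theorems.FluctuationComparisonRegPrIntLS2BetaChartReadCurvedOfPlaqSmall
import HarnessLib

/-!
# S2β · (REG-UP)′ bridge (O2-b3-β2) — «THE ONE-STEP BACKGROUND-LIPSCHITZ LETTER WITH NO GAUGE HYPOTHESIS»: ✓p840374 (O2-b1) read in the two-block axial gauge
# (✓`…ChartReadCurvedOfPlaqSmall.norm_coe_gaugeAct_axialGauge_sub_one_le`) and carried back by the gauge covariance of the derivative (✓`…ChartReadGaugeCovariance.coe_fderiv_chartRead_gaugeAct`):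
# `‖↑(Dψ_{V}(0)X c) − ↑(Dψ_{V′}(0)X c)‖ ≤ 2·67ℓ·(2κ + η)·‖X‖∕a`, `κ = (d−1)·2L·δ`, `η` = the local bondwise distance of `V′` to `V` at `c`

Cell `ym3-torus` (YM ladder rung R3 = continuum `SU(2)` Yang–Mills on the three-torus at fixed lattice data — a RUNG: NOT d = 4, NOT infinite volume, NOT a mass gap,
NOT Clay).  Width seat «width 12» `ym3-torus-px12` (gen 27); crux `stmt-QuantumFields-20520`, LINE g18-1 S2β, node (REG-UP)′ (hDcov assembly, the `hLip` letter of ✓(O2-b3-α), one level).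
`--kind proof --supports stmt-QuantumFields-20520 --as helper`, count-neutral, DEFINITION-FREE (0 `def`, 0 `instance`, 0 `notation`, 0 `sorry`, default heartbeats).  Generic `P : Params`
(`j + 2 ≤ m + K`), `SU(N)`.

THE MECHANISM.  Both sides of the difference are gauge covariant with the SAME conjugating unitary `g(emb c₋)` (✓`coe_fderiv_chartRead_gaugeAct`), so the norm of the difference may be read in any
gauge `g`; in the two-block axial gauge of `V` at `c` (lit ✓`T4AxialGaugeSmallField.axialGauge`), `PlaqSmall δ V` puts `g•V` within `κ = (d−1)·2L·δ` of `1` on every bond issuing from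
`B(c₋) ∪ B(c₊)` (✓`norm_coe_gaugeAct_axialGauge_sub_one_le`), and `g•V′` within `κ + η` (`‖(g•V′)b − (g•V)b‖ = ‖V′b − Vb‖`, unitaries act isometrically); then ✓p840374
`norm_fderiv_chartRead_sub_fderiv_le_of_local` (through the flat background) gives `2·67ℓ(κ + (κ + η))·‖Ad_g X‖∕a`, and `‖Ad_g X‖ ≤ ‖X‖`.

WHAT IS PROVED (sorry-free).  §1 `norm_coe_gaugeAct_sub_gaugeAct` (`‖(g•V′)b − (g•V)b‖ = ‖V′b − Vb‖`), `norm_conjField_le` (`‖Ad_g X‖ ≤ ‖X‖`), `norm_conj_sub_conj_eq`;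
§2 ★★★**`norm_fderiv_chartRead_sub_fderiv_le_of_plaqSmall (hj hj2) (V V′) (hρ0 hρ hα hα′ hα4) (hδ hV : PlaqSmall δ V) (c) (hη : ∀ b, blockOf b₋ ∈ {c₋, c₊} → ‖↑(V′ b) − ↑(V b)‖ ≤ η) (hη0)
(hκℓ : 100ℓ·((d−1)2Lδ + ((d−1)2Lδ + η)) ≤ ρ) (ha0 ha) X : ‖↑(Dψ_{V}(0)X c) − ↑(Dψ_{V′}(0)X c)‖ ≤ 2·(67ℓ·((d−1)2Lδ + ((d−1)2Lδ + η)))·‖X‖∕a`**.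

HONEST SCOPE.  A gauge change around two landed engines; nothing of Bałaban's renormalisation-group analysis proved ([Balaban1985Averaging] pp.24–25, Prop. 3 (121)–(125) p.36 are the printed
loci); the k-step telescope (O2-b3-β3), (hNL)∕(REG-UP)′∕GAP♯∘ (`stub_uniformFibreGapOrbit`, registry 3732b7df UNTOUCHED, 0∕5), the five registered stubs, S2β, crux 20520, 19936, 19200,
`YM3TorusSU2` — NOT proved; rung R3 — NOT d = 4, NOT infinite volume, NOT a mass gap, NOT Clay; the Yang–Mills mass gap is NOT proved.
-/

set_option autoImplicit false

noncomputable section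

open scoped Matrix.Norms.L2Operator Topology
open Filter Set Function

namespace Summit.QuantumFields.YangMills.Theorems.FluctuationComparisonRegPrIntLS2BetaChartReadDerivBkgLipschitzFree

open Literature.MathematicalPhysics.QuantumFieldTheory.Balaban1983to89
open Literature.MathematicalPhysics.QuantumFieldTheory.Balaban1983to89.HaarExponentialChart
open Literature.MathematicalPhysics.QuantumFieldTheory.Balaban1983to89.HaarExponentialChart.IsChartRep
open Literature.MathematicalPhysics.QuantumFieldTheory.Balaban1983to89.BlockAveraging (Small Idx avgFun loopHol)
open Literature.MathematicalPhysics.QuantumFieldTheory.Balaban1983to89.ExpMeanLog (expMeanLogSU deltaSU)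
open Literature.MathematicalPhysics.QuantumFieldTheory.Balaban1983to89.Node00
open Summit.QuantumFields.YangMills.BalabanUVNodes.N09ChartReadAveragingSmooth
open Summit.QuantumFields.YangMills.BalabanUVNodes.N09CentralWindowInjective (norm_coe_SU_le_one)
open Summit.QuantumFields.YangMills.Theorems.FluctuationComparisonRegPrIntLS2BetaCovWalkSumStokes (norm_coe_conj_le)
open Summit.QuantumFields.YangMills.Theorems.FluctuationComparisonRegPrIntLS2BetaChartReadGaugeCovariance (conj_mem_lie dist1_loopHol_gaugeAct coe_fderiv_chartRead_gaugeAct)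
open Summit.QuantumFields.YangMills.Theorems.FluctuationComparisonRegPrIntLS2BetaChartReadDerivBkgLipschitz (norm_fderiv_chartRead_sub_fderiv_le_of_local)
open Summit.QuantumFields.YangMills.Theorems.FluctuationComparisonRegPrIntLS2BetaChartReadCurvedOfPlaqSmall (norm_coe_gaugeAct_axialGauge_sub_one_le)

variable {P : Params} {j : ℕ} {N : ℕ} [NeZero N]

/-! ## §1 Unitary bookkeeping -/

/-- `‖(g•V′)(b) − (g•V)(b)‖ = ‖V′(b) − V(b)‖` — the gauge action conjugates the bond difference by unitaries. [cite: Balaban1985Averaging, (8) p.19] -/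
theorem norm_coe_gaugeAct_sub_gaugeAct (g : GaugeTransf P j (SU N)) (V V' : GaugeField P j (SU N)) (b : PBond P j) :
    ‖((GaugeField.gaugeAct g V' b : SU N) : Matrix (Fin N) (Fin N) ℂ) - ((GaugeField.gaugeAct g V b : SU N) : Matrix (Fin N) (Fin N) ℂ)‖ =
      ‖((V' b : SU N) : Matrix (Fin N) (Fin N) ℂ) - ((V b : SU N) : Matrix (Fin N) (Fin N) ℂ)‖ := by
  have h1 : ((g b.src : SU N) : Matrix (Fin N) (Fin N) ℂ) ∈ unitary (Matrix (Fin N) (Fin N) ℂ) :=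
    Matrix.specialUnitaryGroup_le_unitaryGroup (g b.src).2
  have h2 : ((((g b.tgt)⁻¹ : SU N)) : Matrix (Fin N) (Fin N) ℂ) ∈ unitary (Matrix (Fin N) (Fin N) ℂ) :=
    Matrix.specialUnitaryGroup_le_unitaryGroup ((g b.tgt)⁻¹).2
  have e : ((GaugeField.gaugeAct g V' b : SU N) : Matrix (Fin N) (Fin N) ℂ) - ((GaugeField.gaugeAct g V b : SU N) : Matrix (Fin N) (Fin N) ℂ) =
      ((g b.src : SU N) : Matrix (Fin N) (Fin N) ℂ) * ((((V' b : SU N) : Matrix (Fin N) (Fin N) ℂ) - ((V b : SU N) : Matrix (Fin N) (Fin N) ℂ)) *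
        ((((g b.tgt)⁻¹ : SU N)) : Matrix (Fin N) (Fin N) ℂ)) := by
    show ((g b.src * V' b * (g b.tgt)⁻¹ : SU N) : Matrix (Fin N) (Fin N) ℂ) - ((g b.src * V b * (g b.tgt)⁻¹ : SU N) : Matrix (Fin N) (Fin N) ℂ) = _
    simp only [Submonoid.coe_mul]
    noncomm_ring
  rw [e, CStarRing.norm_mem_unitary_mul _ h1, CStarRing.norm_mul_mem_unitary _ h2]

/-- `‖Ad_g X‖ ≤ ‖X‖` in the sup norm over bonds (`‖g·X_b·g⋆‖ ≤ ‖X_b‖`). [folklore] -/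
theorem norm_conjField_le (g : GaugeTransf P j (SU N)) (X : PBond P j → (specialUnitaryLogChart (Fin N)).lie) :
    ‖(fun b : PBond P j => (⟨((g b.src : SU N) : Matrix (Fin N) (Fin N) ℂ) * ((X b : (specialUnitaryLogChart (Fin N)).lie) : Matrix (Fin N) (Fin N) ℂ) *
        star ((g b.src : SU N) : Matrix (Fin N) (Fin N) ℂ), conj_mem_lie (g b.src) (X b)⟩ : (specialUnitaryLogChart (Fin N)).lie))‖ ≤ ‖X‖ := by
  refine (pi_norm_le_iff_of_nonneg (norm_nonneg X)).2 fun b => ?_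
  rw [← Submodule.norm_coe]
  exact (norm_coe_conj_le (g b.src) _).trans (by rw [Submodule.norm_coe]; exact norm_le_pi_norm X b)

omit [NeZero N] in
/-- `‖G·A·G⋆ − G·B·G⋆‖ = ‖A − B‖` for `G ∈ SU(N)`. [folklore] -/
theorem norm_conj_sub_conj_eq (G : SU N) (A B : Matrix (Fin N) (Fin N) ℂ) :
    ‖(G : Matrix (Fin N) (Fin N) ℂ) * A * star (G : Matrix (Fin N) (Fin N) ℂ) - (G : Matrix (Fin N) (Fin N) ℂ) * B * star (G : Matrix (Fin N) (Fin N) ℂ)‖ = ‖A - B‖ := by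
  have hG : (G : Matrix (Fin N) (Fin N) ℂ) ∈ unitary (Matrix (Fin N) (Fin N) ℂ) := Matrix.specialUnitaryGroup_le_unitaryGroup G.2
  rw [← sub_mul, ← mul_sub, CStarRing.norm_mul_mem_unitary _ (Unitary.star_mem hG), CStarRing.norm_mem_unitary_mul _ hG]

/-! ## §2 The one-step background-Lipschitz letter, gauge-free -/

/-- ★★★ **THE ONE-STEP BACKGROUND-LIPSCHITZ LETTER WITH NO GAUGE HYPOTHESIS.**  For two level-`j` backgrounds `V, V′` in the loop `α`-guard at every coarse bond
(`4α ≤ ρ ≤ innerRadius`, `0 < ρ`), `PlaqSmall δ V` (`0 ≤ δ`), `j + 2 ≤ m + K`, a coarse bond `c`, a LOCAL bondwise distance `‖↑(V′ b) − ↑(V b)‖ ≤ η` on the bonds issuing from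
`B(c₋) ∪ B(c₊)`, the window `100ℓ·(κ + (κ + η)) ≤ ρ` with `κ := (d−1)·2L·δ`, and a radius `0 < a`, `100ℓ(e^a − 1) ≤ ρ`:
**`‖↑(Dψ_{V}(0)X c) − ↑(Dψ_{V′}(0)X c)‖ ≤ 2·(67ℓ·(κ + (κ + η)))·‖X‖∕a`**. [cite: Balaban1985Averaging, (11)-(13) p.19, pp.24-25, Prop. 3 (121)-(125) p.36; Balaban1985UV3, (27) p.263; Balaban1987RG1, (0.4) p.253] -/
theorem norm_fderiv_chartRead_sub_fderiv_le_of_plaqSmall (hj : j + 1 ≤ P.m + P.K) (hj2 : j + 2 ≤ P.m + P.K) (V V' : GaugeField P j (SU N))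
    {α ρ δ η a : ℝ} (hρ0 : 0 < ρ) (hρ : ρ ≤ innerRadius (specialUnitaryLogChart (Fin N)))
    (hα : ∀ c i, dist1 (loopHol V c i) ≤ α) (hα' : ∀ c i, dist1 (loopHol V' c i) ≤ α) (hα4 : 4 * α ≤ ρ)
    (hδ : 0 ≤ δ) (hV : PlaqSmall δ V) (c : PBond P (j + 1))
    (hη : ∀ b : PBond P j, (blockOf b.src = c.src ∨ blockOf b.src = c.tgt) → ‖((V' b : SU N) : Matrix (Fin N) (Fin N) ℂ) - ((V b : SU N) : Matrix (Fin N) (Fin N) ℂ)‖ ≤ η)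
    (hκℓ : 100 * ((((P.d + 2) * P.L : ℕ) : ℝ) * ((((P.d - 1 : ℕ) : ℝ) * ((2 * P.L : ℕ) : ℝ) * δ) + ((((P.d - 1 : ℕ) : ℝ) * ((2 * P.L : ℕ) : ℝ) * δ) + η))) ≤ ρ)
    (ha0 : 0 < a) (ha : 100 * ((((P.d + 2) * P.L : ℕ) : ℝ) * (Real.exp a - 1)) ≤ ρ) (X : PBond P j → (specialUnitaryLogChart (Fin N)).lie) :
    ‖((fderiv ℝ (fun (A : PBond P j → (specialUnitaryLogChart (Fin N)).lie) (c : PBond P (j + 1)) => (isChartRep_specialUnitaryGroup (n := Fin N)).logChart (avgFun (expMeanLogSU (n := Fin N)) (fun b => (isChartRep_specialUnitaryGroup (n := Fin N)).expChart (A b) * V b) c * (avgFun (expMeanLogSU (n := Fin N)) V c)⁻¹)) 0 X c : (specialUnitaryLogChart (Fin N)).lie) : Matrix (Fin N) (Fin N) ℂ) -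
        ((fderiv ℝ (fun (A : PBond P j → (specialUnitaryLogChart (Fin N)).lie) (c : PBond P (j + 1)) => (isChartRep_specialUnitaryGroup (n := Fin N)).logChart (avgFun (expMeanLogSU (n := Fin N)) (fun b => (isChartRep_specialUnitaryGroup (n := Fin N)).expChart (A b) * V' b) c * (avgFun (expMeanLogSU (n := Fin N)) V' c)⁻¹)) 0 X c : (specialUnitaryLogChart (Fin N)).lie) : Matrix (Fin N) (Fin N) ℂ)‖ ≤
      2 * (67 * ((((P.d + 2) * P.L : ℕ) : ℝ) * ((((P.d - 1 : ℕ) : ℝ) * ((2 * P.L : ℕ) : ℝ) * δ) + ((((P.d - 1 : ℕ) : ℝ) * ((2 * P.L : ℕ) : ℝ) * δ) + η)))) * ‖X‖ / a := by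
  -- the two-block axial gauge of `V` at `c`
  set g : GaugeTransf P j (SU N) := T4AxialGaugeSmallField.axialGauge V
    (fun κ : Fin P.d => (((emb c.src κ).val : ℕ) : ℤ) - (((P.L - 1) / 2 : ℕ) : ℤ))
    (fun κ : Fin P.d => (((emb c.src κ).val : ℕ) : ℤ) + ((if c.dir = κ then (P.L : ℤ) else 0) + (((P.L - 1) / 2 : ℕ) : ℤ)) + 1) with hg
  set κ : ℝ := ((P.d - 1 : ℕ) : ℝ) * ((2 * P.L : ℕ) : ℝ) * δ with hκdef
  -- local flatness of `g•V` and `g•V′`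
  have hκ : ∀ b : PBond P j, (blockOf b.src = c.src ∨ blockOf b.src = c.tgt) →
      ‖((GaugeField.gaugeAct g V b : SU N) : Matrix (Fin N) (Fin N) ℂ) - 1‖ ≤ κ := fun b hb =>
    norm_coe_gaugeAct_axialGauge_sub_one_le hj hj2 V hδ hV c b hb
  have hκ' : ∀ b : PBond P j, (blockOf b.src = c.src ∨ blockOf b.src = c.tgt) →
      ‖((GaugeField.gaugeAct g V' b : SU N) : Matrix (Fin N) (Fin N) ℂ) - 1‖ ≤ κ + η := by
    intro b hb
    have e : ((GaugeField.gaugeAct g V' b : SU N) : Matrix (Fin N) (Fin N) ℂ) - 1 =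
        (((GaugeField.gaugeAct g V' b : SU N) : Matrix (Fin N) (Fin N) ℂ) - ((GaugeField.gaugeAct g V b : SU N) : Matrix (Fin N) (Fin N) ℂ)) +
          (((GaugeField.gaugeAct g V b : SU N) : Matrix (Fin N) (Fin N) ℂ) - 1) := by abel
    rw [e]
    refine (norm_add_le _ _).trans ?_
    rw [norm_coe_gaugeAct_sub_gaugeAct, add_comm]
    exact add_le_add (hκ b hb) (hη b hb)
  -- loop guards are gauge invariant
  have hαg : ∀ c' i, dist1 (loopHol (GaugeField.gaugeAct g V) c' i) ≤ α := fun c' i => by rw [dist1_loopHol_gaugeAct]; exact hα c' i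
  have hαg' : ∀ c' i, dist1 (loopHol (GaugeField.gaugeAct g V') c' i) ≤ α := fun c' i => by rw [dist1_loopHol_gaugeAct]; exact hα' c' i
  -- windows
  have hℓ0 : 0 ≤ (((P.d + 2) * P.L : ℕ) : ℝ) := Nat.cast_nonneg _
  have hκ0 : 0 ≤ κ := by rw [hκdef]; positivity
  have hη0 : 0 ≤ η := by
    -- the bond `⟨emb c₋, c.dir⟩` issues from `B(c₋)`
    have hb : blockOf (⟨emb c.src, c.dir⟩ : PBond P j).src = c.src ∨ blockOf (⟨emb c.src, c.dir⟩ : PBond P j).src = c.tgt :=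
      Or.inl (Site.blockOf_emb hj c.src)
    exact (norm_nonneg _).trans (hη _ hb)
  have hκℓ1 : 100 * ((((P.d + 2) * P.L : ℕ) : ℝ) * κ) ≤ ρ := by
    refine le_trans ?_ hκℓ
    have : κ ≤ κ + (κ + η) := by linarith
    nlinarith [hℓ0, this]
  have hκℓ2 : 100 * ((((P.d + 2) * P.L : ℕ) : ℝ) * (κ + η)) ≤ ρ := by
    refine le_trans ?_ hκℓ
    have : κ + η ≤ κ + (κ + η) := by linarith
    nlinarith [hℓ0, this]
  -- ✓p840374 in the gauge `g`, at the conjugated direction `Ad_g X`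
  set Xg : PBond P j → (specialUnitaryLogChart (Fin N)).lie := fun b : PBond P j =>
    (⟨((g b.src : SU N) : Matrix (Fin N) (Fin N) ℂ) * ((X b : (specialUnitaryLogChart (Fin N)).lie) : Matrix (Fin N) (Fin N) ℂ) *
        star ((g b.src : SU N) : Matrix (Fin N) (Fin N) ℂ), conj_mem_lie (g b.src) (X b)⟩ : (specialUnitaryLogChart (Fin N)).lie) with hXg
  have h01 := norm_fderiv_chartRead_sub_fderiv_le_of_local (GaugeField.gaugeAct g V) (GaugeField.gaugeAct g V') hj hρ0 hρ hαg hαg' hα4 hκℓ1 hκℓ2 c hκ hκ' ha0 ha Xg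
  -- gauge covariance of both derivatives with the same conjugating unitary `g (emb c₋)`
  have hcov := coe_fderiv_chartRead_gaugeAct g V hj hρ0 hρ hα hα4 X c
  have hcov' := coe_fderiv_chartRead_gaugeAct g V' hj hρ0 hρ hα' hα4 X c
  rw [hcov, hcov', norm_conj_sub_conj_eq] at h01
  refine h01.trans ?_
  have hXg_le : ‖Xg‖ ≤ ‖X‖ := norm_conjField_le g X
  have hC : 0 ≤ 2 * (67 * ((((P.d + 2) * P.L : ℕ) : ℝ) * (κ + (κ + η)))) := by positivity
  rw [div_le_div_iff_of_pos_right ha0]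
  exact mul_le_mul_of_nonneg_left hXg_le hC

end Summit.QuantumFields.YangMills.Theorems.FluctuationComparisonRegPrIntLS2BetaChartReadDerivBkgLipschitzFree

end
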